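import Summits.Ventures.LatticeQCDFlow.Scaling.ParallelTemperingHalfSweep
import Summits.Ventures.LatticeQCDFlow.Scaling.ParallelTemperingPairCycleTag
import Summits.Ventures.LatticeQCDFlow.Scaling.ParallelTemperingTagWalk

/-!
HONEST FRAMING: exact (Metropolis-corrected) sampling algorithms for lattice gauge theory; figures
of merit are autocorrelation/cost numbers at stated couplings and volumes; no continuum-physics
claim.

# ParallelTemperingHalfSweepWalk — UNDER PERFECT REPLICA REDRAWS THE TAG OF THE HALF-SWEEP PTBC SAMPLER IS THE
# SYMMETRIC LADDER WALK `bdKernel K (½swapAcc_τ) (½swapAcc_{τ−1})` PER HALF-SWEEP — THE SIMULATED-TEMPERING LEVEL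
# WALK WITH OVERLAPS REPLACED BY SWAP ACCEPTANCES (lean-2 GEN-15, ours)

Venture-side (OURS).  Cell `lqcd-flow` (pub-lqcd), unit `pub-lqcd-lean-2-g15`, 2026-08-24.  GEN-14's coda
(`Scaling/SimulatedTemperingLevelWalk`, `Scaling/ParallelTemperingTagWalk`) lumps the level / tag of the tempering
samplers under PERFECT within-level / within-replica sampling (an independent redraw at every step — the ideal of a
trivializing flow) to birth–death walks: simulated tempering `bdKernel K (½ov_k) (½ov_{k−1})` per step, replica
exchange with one uniformly chosen pair `bdKernel K (swapAcc_τ/K) (swapAcc_{τ−1}/K)` per attempt.  This file does the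
same for PTBC as run — the random-parity half-sweep `H` of GEN-15 (`Scaling/ParallelTemperingHalfSweep`): the tag of
`H ∘ₖ ptPerfectSweep` IS `bdKernel K (½swapAcc_τ) (½swapAcc_{τ−1})` per half-sweep, i.e. the simulated-tempering
walk with `ov_k ↦ swapAcc_k`.  With uniform acceptance `a` it is row 22's `ladderWalk K a` and the delivery time is
`K(K+1)/a` half-sweeps.

## What is proved (`X` bounded measurable, `μ` a probability measure)

* §2 (with `Scaling/ParallelTemperingPairCycleTag`: where the tag goes under a sweep over disjoint pairs) for the
  random-parity half-sweep: **`ptHalfSweep_real_up`** (`= ½r_τ(x)`, `τ < K`), **`ptHalfSweep_real_down`**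
  (`= ½r_{τ−1}(x)`, `τ ≥ 1`), `ptHalfSweep_real_self` (`= 1 − ½ptSwapRatio`), `ptHalfSweep_real_far` (`= 0`).
* §3 `ptHalfLadderUp/Down`, **`ptHalfLevelWalk = bdKernel K (½swapAcc_τ·1[τ<K]) (½swapAcc_{τ−1}·1[τ≥1])`**;
  `kernel_perfect_comp_real` (any Markov kernel after the perfect sweep: integrate over `⊗μ_{β_k}`);
  **`ptHalfPerfect_tagKernel_eq_walk`** — `((H ∘ₖ ptPerfectSweep)(τ, x)).real {tag = τ'} = ptHalfLevelWalk τ τ'`;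
  `ptHalfLevelWalk_eq_ladderWalk` (uniform acceptance `a` ⇒ row 22's `ladderWalk K a`),
  **`ptHalfPerfect_delivery_time`** (`E_0(τ_K) = K(K+1)/a` half-sweeps).

NOT CLAIMED: arbitrary-ladder delivery / round-trip times for this walk (companion
`Scaling/ParallelTemperingHalfSweepRoundTrip`); non-perfect replica updates (then the tag is not Markov); anything
measured.  Literature grade (cell rule): KNOWN MECHANISM (ladder random walk), NEW TYPING (kernel-exact lumpability);
nothing cited as a fact; no new bib keys.
-/

noncomputable section

open MeasureTheory ProbabilityTheory Set Filter Finset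
open Summit.Ventures.LatticeQCDFlow.Exactness Literature.Probability.MarkovChains
open scoped ENNReal

namespace Summit.Ventures.LatticeQCDFlow.Scaling

/-! ## §2 (§1 is `Scaling/ParallelTemperingPairCycleTag`) The exact one-step tag distribution of the random-parity half-sweep -/

section HalfTag

variable {Ω : Type*} [MeasurableSpace Ω] {X : Ω → ℝ} {β : ℕ → ℝ} {K : ℕ}

/-- The pair `(τ, τ+1)` belongs to its own parity class. [folklore] -/
theorem mem_ptParityPairs_self (j : Fin K) : j ∈ ptParityPairs K ((j : ℕ) % 2) := by
  unfold ptParityPairs; simp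

/-- No pair of the OTHER parity class sends the tag from `j` to `j+1`. [folklore] -/
theorem ptPerm_ne_succ_of_parity (j : Fin K) :
    ∀ j' ∈ ptParityPairs K (((j : ℕ) + 1) % 2), ptPerm K j' (Fin.castSucc j) ≠ Fin.succ j := by
  intro j' hj' h
  unfold ptParityPairs at hj'
  simp only [List.mem_filter, List.mem_finRange, decide_eq_true_eq, true_and] at hj'
  -- `σ_{j'}` moves `j` at all only if `j ∈ {j', j'+1}`; then `σ_{j'} j = j+1` forces `j' = j`, parity clash
  have hmv : ptPerm K j' (Fin.castSucc j) ≠ Fin.castSucc j := by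
    rw [h]; exact (ne_of_lt Fin.castSucc_lt_succ).symm
  rcases (ptPerm_ne_self_iff j' _).1 hmv with e | e
  · have he := congrArg Fin.val e
    simp only [Fin.val_castSucc] at he
    omega
  · have he := congrArg Fin.val e
    simp only [Fin.val_castSucc, Fin.val_succ] at he
    rw [e, ptPerm_succ] at h
    have hh := congrArg Fin.val h
    simp only [Fin.val_castSucc, Fin.val_succ] at hh
    omega

/-- No pair of the other parity class sends the tag from `j+1` to `j`. [folklore] -/
theorem ptPerm_ne_castSucc_of_parity (j : Fin K) :
    ∀ j' ∈ ptParityPairs K (((j : ℕ) + 1) % 2), ptPerm K j' (Fin.succ j) ≠ Fin.castSucc j := by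
  intro j' hj' h
  have h' : ptPerm K j' (Fin.castSucc j) = Fin.succ j := by
    have := congrArg (ptPerm K j') h
    rw [ptPerm_ptPerm] at this
    exact this.symm
  exact ptPerm_ne_succ_of_parity j j' hj' h'

/-- **ONE RUNG UP: `H(τ, x){tag = τ+1} = ½·r_τ(x)`** (`τ < K`, `j = τ` as an element of `Fin K`). [ours] -/
theorem ptHalfSweep_real_up (hXm : Measurable X) (j : Fin K) (x : Fin (K + 1) → Ω) :
    (ptHalfSweep hXm β K (Fin.castSucc j, x)).real {y | ((y.1 : Fin (K + 1)) : ℕ) = (j : ℕ) + 1} =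
      1 / 2 * ptPairRatio X β K j x := by
  unfold ptHalfSweep
  rw [mixtureKernel_real, coe_oneHalf]
  -- parity of `j`: its own class contributes `r_j`, the other class `0`
  have hown : ∀ p, p = (j : ℕ) % 2 → (ptParitySweep hXm β K p (Fin.castSucc j, x)).real
      {y | ((y.1 : Fin (K + 1)) : ℕ) = (j : ℕ) + 1} = ptPairRatio X β K j x := fun p hp => by
    subst hp
    exact ptPairCycle_real_tag_succ hXm (pairwise_apart_ptParityPairs K _) (mem_ptParityPairs_self j) x
  have hother : ∀ p, p = ((j : ℕ) + 1) % 2 → (ptParitySweep hXm β K p (Fin.castSucc j, x)).real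
      {y | ((y.1 : Fin (K + 1)) : ℕ) = (j : ℕ) + 1} = 0 := fun p hp => by
    subst hp
    have e : {y : Fin (K + 1) × (Fin (K + 1) → Ω) | ((y.1 : Fin (K + 1)) : ℕ) = (j : ℕ) + 1} =
        {y | ((y.1 : Fin (K + 1)) : ℕ) = ((Fin.succ j : Fin (K + 1)) : ℕ)} := by
      ext y; simp
    rw [e]
    exact ptPairCycle_real_tag_eq_zero hXm (pairwise_apart_ptParityPairs K _) (Fin.castSucc j, x)
      (τ' := Fin.succ j) (ne_of_lt Fin.castSucc_lt_succ).symm (ptPerm_ne_succ_of_parity j)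
  rcases Nat.mod_two_eq_zero_or_one (j : ℕ) with h0 | h1
  · have h1' : ((j : ℕ) + 1) % 2 = 1 := by omega
    rw [hown 0 h0.symm, hother 1 h1'.symm]; ring
  · have h0' : ((j : ℕ) + 1) % 2 = 0 := by omega
    rw [hother 0 h0'.symm, hown 1 h1.symm]; ring

/-- **ONE RUNG DOWN: `H(τ, x){tag = τ−1} = ½·r_{τ−1}(x)`** (`τ = j+1 ≥ 1`). [ours] -/
theorem ptHalfSweep_real_down (hXm : Measurable X) (j : Fin K) (x : Fin (K + 1) → Ω) :
    (ptHalfSweep hXm β K (Fin.succ j, x)).real {y | ((y.1 : Fin (K + 1)) : ℕ) = (j : ℕ)} =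
      1 / 2 * ptPairRatio X β K j x := by
  unfold ptHalfSweep
  rw [mixtureKernel_real, coe_oneHalf]
  have hown : ∀ p, p = (j : ℕ) % 2 → (ptParitySweep hXm β K p (Fin.succ j, x)).real
      {y | ((y.1 : Fin (K + 1)) : ℕ) = (j : ℕ)} = ptPairRatio X β K j x := fun p hp => by
    subst hp
    exact ptPairCycle_real_tag_pred hXm (pairwise_apart_ptParityPairs K _) (mem_ptParityPairs_self j) x
  have hother : ∀ p, p = ((j : ℕ) + 1) % 2 → (ptParitySweep hXm β K p (Fin.succ j, x)).real
      {y | ((y.1 : Fin (K + 1)) : ℕ) = (j : ℕ)} = 0 := fun p hp => by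
    subst hp
    have e : {y : Fin (K + 1) × (Fin (K + 1) → Ω) | ((y.1 : Fin (K + 1)) : ℕ) = (j : ℕ)} =
        {y | ((y.1 : Fin (K + 1)) : ℕ) = ((Fin.castSucc j : Fin (K + 1)) : ℕ)} := by
      ext y; simp
    rw [e]
    exact ptPairCycle_real_tag_eq_zero hXm (pairwise_apart_ptParityPairs K _) (Fin.succ j, x)
      (τ' := Fin.castSucc j) (ne_of_lt Fin.castSucc_lt_succ) (ptPerm_ne_castSucc_of_parity j)
  rcases Nat.mod_two_eq_zero_or_one (j : ℕ) with h0 | h1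
  · have h1' : ((j : ℕ) + 1) % 2 = 1 := by omega
    rw [hown 0 h0.symm, hother 1 h1'.symm]; ring
  · have h0' : ((j : ℕ) + 1) % 2 = 0 := by omega
    rw [hother 0 h0'.symm, hown 1 h1.symm]; ring

/-- **STAYING PUT: `H(z){tag = tag z} = 1 − ½·ptSwapRatio(z)`.** [ours] -/
theorem ptHalfSweep_real_self (hXm : Measurable X) (z : Fin (K + 1) × (Fin (K + 1) → Ω)) :
    (ptHalfSweep hXm β K z).real {y | ((y.1 : Fin (K + 1)) : ℕ) = ((z.1 : Fin (K + 1)) : ℕ)} =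
      1 - 1 / 2 * ptSwapRatio X β K z := by
  have hS := measurableSet_tagMoved (Ω := Ω) z
  have e : {y : Fin (K + 1) × (Fin (K + 1) → Ω) | ((y.1 : Fin (K + 1)) : ℕ) = ((z.1 : Fin (K + 1)) : ℕ)} =
      {y | ((y.1 : Fin (K + 1)) : ℕ) ≠ ((z.1 : Fin (K + 1)) : ℕ)}ᶜ := by
    ext y; simp
  rw [e, measureReal_compl hS, probReal_univ, ptHalfSweep_real_moves_eq hXm z]

/-- **NO JUMPS: `H(τ, x){tag = τ'} = 0`** unless `τ' ∈ {τ−1, τ, τ+1}`. [ours] -/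
theorem ptHalfSweep_real_far (hXm : Measurable X) (τ τ' : Fin (K + 1)) (x : Fin (K + 1) → Ω)
    (h1 : (τ' : ℕ) ≠ τ + 1) (h2 : (τ : ℕ) ≠ τ' + 1) (h3 : τ ≠ τ') :
    (ptHalfSweep hXm β K (τ, x)).real {y | ((y.1 : Fin (K + 1)) : ℕ) = (τ' : ℕ)} = 0 := by
  have hkk : (τ : ℕ) ≠ τ' := fun h => h3 (Fin.ext h)
  have hsub : {y : Fin (K + 1) × (Fin (K + 1) → Ω) | ((y.1 : Fin (K + 1)) : ℕ) = (τ' : ℕ)} ⊆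
      {y | ¬ |(((y.1 : Fin (K + 1)) : ℕ) : ℝ) - (((τ, x) : Fin (K + 1) × (Fin (K + 1) → Ω)).1 : ℕ)| ≤ 1} := by
    intro y hy
    simp only [Set.mem_setOf_eq] at hy ⊢
    rw [hy, abs_le]
    rintro ⟨ha, hb⟩
    have ha' : ((τ : ℕ) : ℝ) ≤ (τ' : ℕ) + 1 := by linarith
    have hb' : ((τ' : ℕ) : ℝ) ≤ (τ : ℕ) + 1 := by linarith
    have ha'' : (τ : ℕ) ≤ (τ' : ℕ) + 1 := by exact_mod_cast ha'
    have hb'' : (τ' : ℕ) ≤ (τ : ℕ) + 1 := by exact_mod_cast hb'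
    omega
  rw [measureReal_def, measure_mono_null hsub (ae_iff.1 (ptHalfSweep_nearestNeighbour hXm (β := β) (τ, x))),
    ENNReal.toReal_zero]

end HalfTag

/-! ## §3 The lumped walk per half-sweep under perfect replica redraws -/

section Walk

variable {Ω : Type*} [MeasurableSpace Ω]

/-- Up-rates of the lumped tag walk per half-sweep: `½·swapAcc(β_τ, β_{τ+1})` below the top. [ours] -/
def ptHalfLadderUp (X : Ω → ℝ) (μ : Measure Ω) (β : ℕ → ℝ) (K : ℕ) (k : ℕ) : ℝ :=
  if k < K then swapAcc X μ (β k) (β (k + 1)) / 2 else 0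

/-- Down-rates: `½·swapAcc(β_{τ−1}, β_τ)` above the bottom. [ours] -/
def ptHalfLadderDown (X : Ω → ℝ) (μ : Measure Ω) (β : ℕ → ℝ) (k : ℕ) : ℝ :=
  if k = 0 then 0 else swapAcc X μ (β (k - 1)) (β k) / 2

/-- **The lumped tag walk per half-sweep** — the simulated-tempering level walk with overlaps replaced by swap
acceptances. [ours] -/
def ptHalfLevelWalk (X : Ω → ℝ) (μ : Measure Ω) (β : ℕ → ℝ) (K : ℕ) : Matrix (Fin (K + 1)) (Fin (K + 1)) ℝ :=
  bdKernel K (ptHalfLadderUp X μ β K) (ptHalfLadderDown X μ β)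

variable {X : Ω → ℝ} {μ : Measure Ω} {β : ℕ → ℝ} {K : ℕ}

/-- `(κ ∘ₖ W_perfect)(τ, x)(T) = ∫ κ(τ, x')(T) d(⊗μ_{β_k})(x')` for every Markov kernel `κ`. [ours] -/
theorem kernel_perfect_comp_real (κ : Kernel (Fin (K + 1) × (Fin (K + 1) → Ω)) (Fin (K + 1) × (Fin (K + 1) → Ω)))
    [IsMarkovKernel κ] (τ : Fin (K + 1)) (x : Fin (K + 1) → Ω) {T : Set (Fin (K + 1) × (Fin (K + 1) → Ω))}
    (hT : MeasurableSet T) :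
    ((κ ∘ₖ ptPerfectSweep X μ β K) (τ, x)).real T =
      ∫ x', (κ (τ, x')).real T ∂(Measure.pi fun k : Fin (K + 1) => μ.tilted fun x => β k * X x) := by
  rw [measureReal_def, Kernel.comp_apply' _ _ _ hT]
  unfold ptPerfectSweep
  rw [lintegral_stWithinLevel _ (κ.measurable_coe hT), Kernel.const_apply]
  dsimp only
  simp only [measureReal_def]
  have hf : Measurable fun x' : Fin (K + 1) → Ω => κ (τ, x') T := (κ.measurable_coe hT).comp measurable_prodMk_left
  rw [integral_toReal hf.aemeasurable (ae_of_all _ fun x' => measure_lt_top _ _)]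

variable [IsProbabilityMeasure μ]

/-- **THE TAG OF THE PERFECTLY-SWEPT HALF-SWEEP PTBC SAMPLER IS THE LUMPED WALK PER HALF-SWEEP**: for all `τ, τ'`
and every replica configuration `x`, `((H ∘ₖ W_perfect)(τ, x)).real {tag = τ'} = ptHalfLevelWalk X μ β K τ τ'`.
[ours] -/
theorem ptHalfPerfect_tagKernel_eq_walk (hXm : Measurable X) (hXb : ∃ C, ∀ x, |X x| ≤ C)
    (τ τ' : Fin (K + 1)) (x : Fin (K + 1) → Ω) :
    ((ptHalfSweep hXm β K ∘ₖ ptPerfectSweep X μ β K) (τ, x)).real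
        {y | ((y.1 : Fin (K + 1)) : ℕ) = (τ' : ℕ)} = ptHalfLevelWalk X μ β K τ τ' := by
  haveI := isProbabilityMeasure_pi_tilted (μ := μ) (β := β) (K := K) hXm hXb
  have hT : MeasurableSet {y : Fin (K + 1) × (Fin (K + 1) → Ω) | ((y.1 : Fin (K + 1)) : ℕ) = (τ' : ℕ)} :=
    measurable_ptLevel (measurableSet_singleton _)
  rw [kernel_perfect_comp_real _ τ x hT]
  unfold ptHalfLevelWalk
  by_cases h1 : (τ' : ℕ) = τ + 1
  · have hτ : (τ : ℕ) < K := by have := τ'.isLt; omega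
    set j : Fin K := ⟨τ, hτ⟩ with hj
    have eτ : τ = Fin.castSucc j := Fin.ext (by simp [hj])
    have e : ∀ x', (ptHalfSweep hXm β K (τ, x')).real {y | ((y.1 : Fin (K + 1)) : ℕ) = (τ' : ℕ)} =
        1 / 2 * ptPairRatio X β K j x' := fun x' => by
      rw [h1, eτ]
      simp only [Fin.val_castSucc]
      exact ptHalfSweep_real_up hXm j x'
    simp only [e]
    rw [integral_const_mul, integral_ptPairRatio_eq_swapAcc hXm hXb, bdKernel_apply_succ h1]
    unfold ptHalfLadderUp
    rw [if_pos hτ]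
    simp only [hj]
    ring
  by_cases h2 : (τ : ℕ) = τ' + 1
  · have hτ' : (τ' : ℕ) < K := by have := τ.isLt; omega
    set j : Fin K := ⟨τ', hτ'⟩ with hj
    have eτ : τ = Fin.succ j := Fin.ext (by simp [hj, h2])
    have e : ∀ x', (ptHalfSweep hXm β K (τ, x')).real {y | ((y.1 : Fin (K + 1)) : ℕ) = (τ' : ℕ)} =
        1 / 2 * ptPairRatio X β K j x' := fun x' => by
      rw [eτ]
      have e' : ((τ' : Fin (K + 1)) : ℕ) = (j : ℕ) := by simp [hj]
      rw [e']
      exact ptHalfSweep_real_down hXm j x'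
    simp only [e]
    rw [integral_const_mul, integral_ptPairRatio_eq_swapAcc hXm hXb, bdKernel_apply_pred h2]
    unfold ptHalfLadderDown
    rw [if_neg (by omega)]
    have e1 : (τ : ℕ) - 1 = j := by simp [hj]; omega
    have e2 : ((j : ℕ) : ℕ) + 1 = τ := by simp [hj]; omega
    rw [e1, ← e2]
    ring
  by_cases h3 : τ = τ'
  · subst h3
    simp only [ptHalfSweep_real_self hXm]
    have hsr : Integrable (fun x' => ptSwapRatio X β K (τ, x'))
        (Measure.pi fun k : Fin (K + 1) => μ.tilted fun x => β k * X x) :=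
      Integrable.of_bound ((measurable_ptSwapRatio (β := β) hXm).comp measurable_prodMk_left).aestronglyMeasurable
        (2 * K) (ae_of_all _ fun x' => by
          rw [Real.norm_eq_abs, abs_of_nonneg (ptSwapRatio_nonneg _)]; exact ptSwapRatio_le _)
    rw [integral_sub (integrable_const 1) (hsr.const_mul _), integral_const, probReal_univ, one_smul,
      integral_const_mul, integral_ptSwapRatio_level hXm hXb, bdKernel_apply_self]
    unfold ptTagCoef ptHalfLadderUp ptHalfLadderDown
    simp only [add_mul, ite_mul, one_mul, zero_mul, Finset.sum_add_distrib]
    rw [sum_ite_castSucc_eq (fun n => swapAcc X μ (β n) (β (n + 1))) τ,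
      sum_ite_succ_eq (fun n => swapAcc X μ (β n) (β (n + 1))) τ]
    by_cases hA : (τ : ℕ) < K <;> by_cases hB : 1 ≤ (τ : ℕ)
    · have hC : (τ : ℕ) ≠ 0 := by omega
      simp only [if_pos hA, if_pos hB, if_neg hC, Nat.sub_add_cancel hB]; ring
    · have hC : (τ : ℕ) = 0 := by omega
      simp only [if_pos hA, if_neg hB, if_pos hC]; ring
    · have hC : (τ : ℕ) ≠ 0 := by omega
      simp only [if_neg hA, if_pos hB, if_neg hC, Nat.sub_add_cancel hB]; ring
    · have hC : (τ : ℕ) = 0 := by omega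
      simp only [if_neg hA, if_neg hB, if_pos hC]; ring
  · simp only [ptHalfSweep_real_far hXm τ τ' _ h1 h2 h3, integral_zero]
    rw [bdKernel_apply_of_ne h1 h2 h3]

omit [IsProbabilityMeasure μ] in
/-- Uniform swap acceptance `a` along the ladder ⇒ the lumped walk per half-sweep IS row 22's `ladderWalk K a`.
[ours] -/
theorem ptHalfLevelWalk_eq_ladderWalk {a : ℝ} (h : ∀ j, j < K → swapAcc X μ (β j) (β (j + 1)) = a) :
    ptHalfLevelWalk X μ β K = ladderWalk K a := by
  unfold ptHalfLevelWalk ladderWalk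
  have hu : ptHalfLadderUp X μ β K = ladderUp K a := by
    funext j; unfold ptHalfLadderUp ladderUp
    split_ifs with hj
    · rw [h j hj]
    · rfl
  have hd : ∀ j, j ≤ K → ptHalfLadderDown X μ β j = ladderDown a j := by
    intro j hj; unfold ptHalfLadderDown ladderDown
    split_ifs with hj0
    · rfl
    · have hj' := h (j - 1) (by omega)
      rw [show j - 1 + 1 = j by omega] at hj'
      rw [hj']
  rw [hu]
  ext i j
  simp only [bdKernel, Matrix.of_apply, hd i i.is_le]

omit [IsProbabilityMeasure μ] in
/-- **DELIVERY TIME IN HALF-SWEEPS, uniform acceptance** (row 22's `ladder_delivery_time'`): `E_0(τ_K) = K(K+1)/a`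
half-sweeps for the tag of the perfectly-swept half-sweep PTBC sampler. [ours] -/
theorem ptHalfPerfect_delivery_time {a : ℝ} (ha0 : 0 < a) (ha1 : a ≤ 1)
    (h : ∀ j, j < K → swapAcc X μ (β j) (β (j + 1)) = a) :
    ∃ hit : Fin (K + 1) → Fin (K + 1) → ℝ, IsHittingTimeSolution (ptHalfLevelWalk X μ β K) hit ∧
      hit 0 (Fin.last K) = (K : ℝ) * (K + 1) / a := by
  rw [ptHalfLevelWalk_eq_ladderWalk h]
  exact ladder_delivery_time' K ha0 ha1

end Walk

end Summit.Ventures.LatticeQCDFlow.Scaling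

end
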